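import Literature.Analysis.FluidPDE.FluidComputer.LatticeSymmetry
import Literature.Analysis.FluidPDE.FluidComputer.GalileanInvariance
import Literature.Analysis.FluidPDE.FluidComputer.PlanarEnstrophyConservation
import Literature.Analysis.FluidPDE.FluidComputer.TimeReversal

/-!
# Space-group symmetries of the truncated system: half-period translations, the quarter turn about
# `x = y = π/2`, and the EMPTY MIXED-PARITY MODES of Taylor–Green and Kida–Pelz runs

HONEST FRAMING (cell `pub-fluidc`, verbatim): *low prior, high value-of-information experiment on Tao's
machine paradigm; NOT a claim that NS blows up.* Typed infrastructure about the finite Galerkin system a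
dealiased pseudo-spectral code integrates (`ShellTransfer.IsGalerkinSolution`); nothing here concerns the
Navier–Stokes PDE itself.

`GalileanInvariance` typed the translations `τ_a : û(k) ↦ e^{-ik·a} û(k)` and `LatticeSymmetry` the point group
`g : û(k) ↦ M û(Mᵀk)` with the persistence principle (equivariance + `GalerkinODE.galerkin_unique`). This file
composes them into SPACE-GROUP elements `(M, a) : x ↦ Mx + a` (`LatticeIsometry.sg g a = τ_a ∘ g`) and names
the classical symmetries of the two production data that are NOT point symmetries at the origin:

* translations alone: `translate_isSupportedOn`, `isGalerkinSolution_translate_unforced`,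
  **`translate_eq_self`** (persistence of a translation symmetry), `truncEnergy_translate`,
  `truncEnstrophy_translate`;
* half-period phases: `phase_eq_neg_one_zpow` (`k·a = nπ ⇒ e^{-ik·a} = (-1)^{-n}`),
  `phase_eq_neg_one_of_odd`, `phase_eq_one_of_even`; the vectors `halfX = (π,0,0)`, `halfXY = (π,π,0)`,
  `halfXZ = (π,0,π)` with `rdot_halfX/_halfXY/_halfXZ`;
* **THE FACE-DIAGONAL HALF TRANSLATIONS FIX BOTH DATA** (every carried wavevector of `tg` and of `kp` has
  three ODD entries: `TaylorGreenHat.odd_of_coeff_ne_zero`, `KidaPelzHat.odd_of_coeff_ne_zero`):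
  `translate_halfXY_tg`, `translate_halfXZ_tg`, `translate_halfXY_kp`, `translate_halfXZ_kp`; a field fixed by
  both translations vanishes on every wavevector of MIXED PARITY (`UniformParity k` := the three entries are all
  even or all odd; `coeff_eq_zero_of_not_uniformParity`) — the typed form of the selection rule "`(l,m,n)` all
  odd or even" of the symmetry-adapted expansions [cite: NgBhattacharjee2002, §2 eq. (3)]; hence
  **`tg_mixedParity_zero` / `kp_mixedParity_zero`**: along every unforced Galerkin solution (any `ν`, any
  pressure multiplier, ANY mode set `S`) supported in `S` and passing through `tg` or `kp`, `û(k,t) = 0` for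
  every mixed-parity `k` and every `t` (`tg_modalEnergy_mixedParity`: they carry no energy). USE (dns-A /
  dns-B / GRID / ATLAS): both engines evolve these data on the full periodic box WITHOUT imposing any symmetry,
  so the energy found in mixed-parity modes of a TG / KP run (3/4 of all wavevectors) is a free meter of
  round-off error and of its dynamical amplification — in exact arithmetic it is identically zero;
* space-group elements: `LatticeIsometry.sg`, `isGalerkinSolution_sg`, `sg_isSupportedOn`, **`sg_eq_self`**
  (persistence), `modalEnergy_sg`, `truncEnergy_sg`, `truncEnstrophy_sg`; commutation with real scalings
  `act_scale`, `translate_scale`, `scale_neg_one_scale_neg_one`;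
* **THE QUARTER TURN ABOUT THE AXIS `x = y = π/2`** (`x ↦ rotZ·x + (π,0,0) = (π − y, x, z)`): the half-period
  shift along `x` reverses both data (`translate_halfX_tg/_kp = scale (-1) ·`, all first entries odd) and so
  do the odd point operations (`rotZ_act_tg`, `swapXY_act_tg`, `KidaPelzHat.swapXY_act_kp` of LatticeSymmetry
  v3; `KidaPelzHat.rotZ_act_kp` here), hence **`rotZ_sg_halfX_tg : rotZ.sg halfX tg = tg`** — the rotational
  symmetry "of `π/2` around the third axis `x = y = π/2`" of the Taylor–Green vortex, with its consequence
  `v_y(x,y,z) = −v_x(π−y,x,z)` [cite: LeeEtAl2008TGMHD, §II (arXiv p. 4)] (that paper lists the TG symmetries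
  used since Brachet et al. 1983 to compute in the fundamental box: mirror (anti)symmetry planes
  `x, y, z = 0, π`, rotations by `π` about `x = z = π/2` and `y = z = π/2`, rotation by `π/2` about
  `x = y = π/2`) — and **`KidaPelzHat.rotZ_sg_halfX_kp : rotZ.sg halfX kp = kp`** (the Kida–Pelz flow "has all
  the symmetries of the TG vortex and also displays additional symmetries" [cite: CichowlasBrachet2005, p. 240];
  with `cycleXYZ_act_kp` the quarter turns about the other two such axes follow); also `swapXY_sg_halfX_tg`,
  `swapXY_sg_halfX_kp`; persistence corollaries `tg_rotZ_sg_persists`, `kp_rotZ_sg_persists`,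
  `tg_swapXY_sg_persists`.

* the PRINTED Taylor–Green symmetry list completed: `halfYZ = (0,π,π)`, `translate_halfYZ_tg/_kp`, `rotYpi`,
  `rotXpi` (`rotYpi_act_eq : rotYpi·A = reflX·(reflZ·A)`), **`rotYpi_sg_halfXZ_tg`** (rotation by `π` about
  `x = z = π/2`), **`rotXpi_sg_halfYZ_tg`** (about `y = z = π/2`) [cite: LeeEtAl2008TGMHD, §II], and `…_kp`;
* spectral symmetry of the runs: `LatticeIsometry.modalEnergy_invK_of_act_eq`, `kp_modalEnergy_cycle`
  (`E(k₁,k₂,k₀;t) = E(k;t)` along KP runs), `kp_modalEnergy_reflX`, `tg_modalEnergy_reflX`, `tg_modalEnergy_rotZ`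
  (`E(k₁,−k₀,k₂;t) = E(k;t)` along TG runs) — free row-level diagnostics of CL-tg / CL-kp spectra;
* **HELICITY VANISHES IDENTICALLY ALONG TG / KP RUNS**: `modalHelicity_reflX_act` (`H[reflX·û](k) = −H[û](Mᵀk)`:
  helicity is a pseudoscalar), `truncHelicity_reflX_act`, `truncHelicity_eq_zero_of_reflX`, and with the persisting
  mirror symmetry **`tg_truncHelicity_zero`, `kp_truncHelicity_zero`** (`H_S(t) = 0` for all `t`, any `ν`): the
  helicity column of CL-tg / CL-kp rows is pure round-off;
* **INVISCID TG/KP RUNS ARE EVEN IN TIME** (with `TimeReversal`): the body-diagonal half translation `halfXYZ =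
  (π,π,π)` reverses both data (`translate_halfXYZ_tg/_kp`, all entries odd), and `t ↦ −û(−t)` solves truncated Euler,
  so by uniqueness **`tg_translate_halfXYZ_eq_reverse` / `kp_…`: `τ_{(π,π,π)} û(t) = −û(−t)`**; hence
  `tg/kp_modalEnergy_even` (every modal energy, so `E_K`, `Z_S`, the spectra, are EVEN functions of time:
  `tg_truncEnstrophy_even`) and `tg/kp_modeTransfer_odd`, `tg_shellTransfer_odd` (transfers are ODD in time) —
  the inviscid CL-tg / CL-kp curves have Taylor series at `t = 0` with only even (resp. odd) powers
  (`modeTransfer_scale`, `modeTransfer_reverse`, `modalEnergy_reverse`);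
* **PLANARITY PERSISTS** (with `PlanarEnstrophyConservation`): a field is planar iff fixed by every vertical
  translation `vertical a = (0,0,a)` and by `reflZ` (`translate_vertical_of_planar`, `reflZ_act_of_planar`,
  `isPlanar_of_invariant`; `coeff_eq_zero_of_translate_eq_self`); hence `isPlanar_persists` along unforced Galerkin
  solutions on `reflZ`-symmetric mode sets, and the unconditional two-dimensional conservation law
  **`truncEnstrophy_eq_of_planar_datum`**: an unforced inviscid Galerkin solution that is planar at ONE time has
  constant enstrophy `Z_S` (`truncEnstrophy_antitone_of_planar_datum` for `ν ≥ 0`).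

[folklore: the space group of a periodic flow = lattice translations ⋊ point group; equivariance of the
Fourier–Galerkin truncation under it] 0 sorry, 0 named facts (D-0026).
-/

noncomputable section

namespace Literature.Analysis.FluidPDE.FluidComputer

open Complex ComplexConjugate Finset
open scoped BigOperators

namespace ShellTransfer

/-! ## Translations: support, unforced solutions, persistence -/

/-- Translation preserves support in a mode set. [folklore] -/
theorem translate_isSupportedOn (a : Fin 3 → ℝ) {U : ℝ → FourierVelocity} {S : Finset (Fin 3 → ℤ)}
    (hs : IsSupportedOn U S) : IsSupportedOn (fun t => translate a (U t)) S := by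
  intro t k hk
  funext j
  rw [translate_coeff, hs t k hk, Pi.zero_apply, mul_zero]

/-- Translations map UNFORCED Galerkin solutions to unforced Galerkin solutions (same `ν`; the pressure
multiplier picks up the phase). [cite: Frisch1995Turbulence, §2.2 p. 17] -/
theorem isGalerkinSolution_translate_unforced {U : ℝ → FourierVelocity} {S : Finset (Fin 3 → ℤ)} {ν : ℝ}
    {c : ℝ → (Fin 3 → ℤ) → ℂ} (hU : IsGalerkinSolution U S ν c fun _ _ _ => 0) (a : Fin 3 → ℝ) :
    IsGalerkinSolution (fun t => translate a (U t)) S ν (fun t k => phase a k * c t k) fun _ _ _ => 0 := by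
  have h := isGalerkinSolution_translate hU a
  have e : (fun (t : ℝ) (k : Fin 3 → ℤ) (j : Fin 3) =>
      phase a k * (fun (_ : ℝ) (_ : Fin 3 → ℤ) (_ : Fin 3) => (0 : ℂ)) t k j) = fun _ _ _ => 0 := by
    funext t k j
    exact mul_zero _
  rw [e] at h
  exact h

/-- **PERSISTENCE OF A TRANSLATION SYMMETRY.** An unforced Galerkin solution supported in `S` whose datum is
invariant under the translation by `a` at one time is invariant at every time (`GalerkinODE.galerkin_unique`).
[folklore] -/
theorem translate_eq_self {U : ℝ → FourierVelocity} {S : Finset (Fin 3 → ℤ)} {ν : ℝ}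
    {c : ℝ → (Fin 3 → ℤ) → ℂ} (hU : IsGalerkinSolution U S ν c fun _ _ _ => 0) (hs : IsSupportedOn U S)
    (a : Fin 3 → ℝ) {t₀ : ℝ} (h0 : translate a (U t₀) = U t₀) (t : ℝ) : translate a (U t) = U t :=
  GalerkinODE.galerkin_unique S (isGalerkinSolution_translate_unforced hU a) hU
    (translate_isSupportedOn a hs) hs h0 t

/-- Translations preserve the truncated energy on every mode set. [folklore] -/
theorem truncEnergy_translate (a : Fin 3 → ℝ) (A : FourierVelocity) (S : Finset (Fin 3 → ℤ)) :
    truncEnergy (translate a A) S = truncEnergy A S := by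
  unfold truncEnergy
  exact Finset.sum_congr rfl fun k _ => modalEnergy_translate a A k

/-- Translations preserve the truncated enstrophy on every mode set. [folklore] -/
theorem truncEnstrophy_translate (a : Fin 3 → ℝ) (A : FourierVelocity) (S : Finset (Fin 3 → ℤ)) :
    truncEnstrophy (translate a A) S = truncEnstrophy A S := by
  unfold truncEnstrophy
  exact Finset.sum_congr rfl fun k _ => by rw [modalEnergy_translate]

/-! ## Phases at half periods: `e^{-iπn} = (-1)^n` -/

/-- If `k·a = nπ` then `e^{-ik·a} = (-1)^{-n}`. [folklore] -/
theorem phase_eq_neg_one_zpow {a : Fin 3 → ℝ} {k : Fin 3 → ℤ} {n : ℤ} (h : rdot k a = n * Real.pi) :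
    phase a k = (-1 : ℂ) ^ (-n) := by
  unfold phase
  rw [h]
  have e : (((-(n * Real.pi) : ℝ)) : ℂ) * I = ((-n : ℤ) : ℂ) * ((Real.pi : ℂ) * I) := by
    push_cast
    ring
  rw [e, Complex.exp_int_mul, Complex.exp_pi_mul_I]

/-- If `k·a = nπ` with `n` odd then `e^{-ik·a} = -1`. [folklore] -/
theorem phase_eq_neg_one_of_odd {a : Fin 3 → ℝ} {k : Fin 3 → ℤ} {n : ℤ} (h : rdot k a = n * Real.pi)
    (hn : Odd n) : phase a k = -1 := by
  rw [phase_eq_neg_one_zpow h]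
  exact hn.neg.neg_one_zpow

/-- If `k·a = nπ` with `n` even then `e^{-ik·a} = 1`. [folklore] -/
theorem phase_eq_one_of_even {a : Fin 3 → ℝ} {k : Fin 3 → ℤ} {n : ℤ} (h : rdot k a = n * Real.pi)
    (hn : Even n) : phase a k = 1 := by
  rw [phase_eq_neg_one_zpow h]
  exact hn.neg.neg_one_zpow

/-- The half period along `x`: `a = (π, 0, 0)`. [folklore] -/
def halfX : Fin 3 → ℝ := ![Real.pi, 0, 0]

/-- The half-diagonal of the `xy` face: `a = (π, π, 0)`. [folklore] -/
def halfXY : Fin 3 → ℝ := ![Real.pi, Real.pi, 0]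

/-- The half-diagonal of the `xz` face: `a = (π, 0, π)`. [folklore] -/
def halfXZ : Fin 3 → ℝ := ![Real.pi, 0, Real.pi]

/-- `k·(π,0,0) = k₀π`. [folklore] -/
theorem rdot_halfX (k : Fin 3 → ℤ) : rdot k halfX = ((k 0 : ℤ) : ℝ) * Real.pi := by
  unfold rdot halfX
  simp [Fin.sum_univ_three]

/-- `k·(π,π,0) = (k₀+k₁)π`. [folklore] -/
theorem rdot_halfXY (k : Fin 3 → ℤ) : rdot k halfXY = ((k 0 + k 1 : ℤ) : ℝ) * Real.pi := by
  unfold rdot halfXY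
  simp [Fin.sum_univ_three]
  ring

/-- `k·(π,0,π) = (k₀+k₂)π`. [folklore] -/
theorem rdot_halfXZ (k : Fin 3 → ℤ) : rdot k halfXZ = ((k 0 + k 2 : ℤ) : ℝ) * Real.pi := by
  unfold rdot halfXZ
  simp [Fin.sum_univ_three]
  ring

/-- `±1` is odd. [folklore] -/
theorem odd_of_mem_pmOne {a : ℤ} (h : a ∈ pmOne) : Odd a := by
  rcases mem_pmOne.mp h with rfl | rfl
  · exact ⟨0, by norm_num⟩
  · exact ⟨-1, by norm_num⟩

/-- `±3` is odd. [folklore] -/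
theorem odd_of_mem_pmThree {a : ℤ} (h : a ∈ pmThree) : Odd a := by
  rcases mem_pmThree.mp h with rfl | rfl
  · exact ⟨1, by norm_num⟩
  · exact ⟨-2, by norm_num⟩

/-! ## The two classical data are invariant under the face-diagonal half translations

Both the Taylor–Green modes `(±1,±1,±1)` and the Kida–Pelz modes (`{±1}×{±3}×{±1}` and its cyclic images)
have all three entries ODD, so `k₀ + k₁` and `k₀ + k₂` are even on every carried mode: the data are
invariant under the translations by `(π,π,0)` and `(π,0,π)` (and `(0,π,π)`), and these invariances persist.
A field invariant under both translations vanishes on every wavevector of MIXED PARITY — the typed form of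
the condition "`(l, m, n)` all odd or all even" of the symmetry-adapted expansions
[cite: NgBhattacharjee2002, §2 eq. (3)]; so along every Taylor–Green or Kida–Pelz Galerkin run (full periodic
box, symmetries NOT imposed — as in both engines of the cell) the mixed-parity modes stay EXACTLY zero, and
any energy measured in them is round-off error (possibly amplified by the dynamics). [folklore] -/

/-- A field invariant under the translation by `(π,π,0)` vanishes wherever `k₀ + k₁` is odd. [folklore] -/
theorem coeff_eq_zero_of_translate_halfXY {A : FourierVelocity} (h : translate halfXY A = A) {k : Fin 3 → ℤ}
    (hk : Odd (k 0 + k 1)) : A.coeff k = 0 := by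
  funext j
  have hc := congrArg (fun B : FourierVelocity => B.coeff k j) h
  simp only [translate_coeff] at hc
  rw [phase_eq_neg_one_of_odd (rdot_halfXY k) hk] at hc
  -- `-û = û`
  have h2 : (2 : ℂ) * A.coeff k j = 0 := by linear_combination -hc
  simpa using h2

/-- A field invariant under the translation by `(π,0,π)` vanishes wherever `k₀ + k₂` is odd. [folklore] -/
theorem coeff_eq_zero_of_translate_halfXZ {A : FourierVelocity} (h : translate halfXZ A = A) {k : Fin 3 → ℤ}
    (hk : Odd (k 0 + k 2)) : A.coeff k = 0 := by
  funext j
  have hc := congrArg (fun B : FourierVelocity => B.coeff k j) h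
  simp only [translate_coeff] at hc
  rw [phase_eq_neg_one_of_odd (rdot_halfXZ k) hk] at hc
  have h2 : (2 : ℂ) * A.coeff k j = 0 := by linear_combination -hc
  simpa using h2

/-- A wavevector has UNIFORM PARITY when its three entries are all even or all odd. [folklore] -/
def UniformParity (k : Fin 3 → ℤ) : Prop := (Even (k 0) ↔ Even (k 1)) ∧ (Even (k 0) ↔ Even (k 2))

/-- A wavevector of mixed parity has `k₀ + k₁` odd or `k₀ + k₂` odd. [folklore] -/
theorem odd_sum_of_not_uniformParity {k : Fin 3 → ℤ} (hk : ¬UniformParity k) :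
    Odd (k 0 + k 1) ∨ Odd (k 0 + k 2) := by
  unfold UniformParity at hk
  simp only [Int.even_iff, Int.odd_iff] at hk ⊢
  omega

/-- **A field invariant under both face-diagonal half translations lives on the uniform-parity wavevectors.**
[folklore; cf. [cite: NgBhattacharjee2002, §2 eq. (3)]] -/
theorem coeff_eq_zero_of_not_uniformParity {A : FourierVelocity} (hXY : translate halfXY A = A)
    (hXZ : translate halfXZ A = A) {k : Fin 3 → ℤ} (hk : ¬UniformParity k) : A.coeff k = 0 := by
  rcases odd_sum_of_not_uniformParity hk with h | h
  · exact coeff_eq_zero_of_translate_halfXY hXY h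
  · exact coeff_eq_zero_of_translate_halfXZ hXZ h

/-- A field supported on wavevectors with all entries odd is invariant under the translation by `(π,π,0)`.
[folklore] -/
theorem translate_halfXY_eq_self_of_odd {A : FourierVelocity}
    (hA : ∀ k, A.coeff k ≠ 0 → Odd (k 0) ∧ Odd (k 1) ∧ Odd (k 2)) : translate halfXY A = A := by
  refine TaylorGreenHat.fourierVelocity_ext ?_
  funext k j
  rw [translate_coeff]
  by_cases hk : A.coeff k = 0
  · simp [hk]
  · obtain ⟨h0, h1, -⟩ := hA k hk
    rw [phase_eq_one_of_even (rdot_halfXY k) (h0.add_odd h1), one_mul]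

/-- A field supported on wavevectors with all entries odd is invariant under the translation by `(π,0,π)`.
[folklore] -/
theorem translate_halfXZ_eq_self_of_odd {A : FourierVelocity}
    (hA : ∀ k, A.coeff k ≠ 0 → Odd (k 0) ∧ Odd (k 1) ∧ Odd (k 2)) : translate halfXZ A = A := by
  refine TaylorGreenHat.fourierVelocity_ext ?_
  funext k j
  rw [translate_coeff]
  by_cases hk : A.coeff k = 0
  · simp [hk]
  · obtain ⟨h0, -, h2⟩ := hA k hk
    rw [phase_eq_one_of_even (rdot_halfXZ k) (h0.add_odd h2), one_mul]

/-- The Taylor–Green datum is carried by all-odd wavevectors. [folklore] -/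
theorem TaylorGreenHat.odd_of_coeff_ne_zero (k : Fin 3 → ℤ) (h : TaylorGreenHat.tg.coeff k ≠ 0) :
    Odd (k 0) ∧ Odd (k 1) ∧ Odd (k 2) := by
  by_cases hk : k ∈ TaylorGreenHat.modes
  · obtain ⟨h0, h1, h2⟩ := TaylorGreenHat.mem_modes.mp hk
    exact ⟨odd_of_mem_pmOne h0, odd_of_mem_pmOne h1, odd_of_mem_pmOne h2⟩
  · exact (h (TaylorGreenHat.coeff_of_not_mem hk)).elim

/-- The Kida–Pelz datum is carried by all-odd wavevectors. [folklore] -/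
theorem KidaPelzHat.odd_of_coeff_ne_zero (k : Fin 3 → ℤ) (h : KidaPelzHat.kp.coeff k ≠ 0) :
    Odd (k 0) ∧ Odd (k 1) ∧ Odd (k 2) := by
  by_cases h1 : k ∈ KidaPelzHat.M1
  · obtain ⟨h0, h1', h2⟩ := (KidaPelzHat.mem_box.mp h1 : _)
    exact ⟨odd_of_mem_pmOne h0, odd_of_mem_pmThree h1', odd_of_mem_pmOne h2⟩
  by_cases h2 : k ∈ KidaPelzHat.M2
  · obtain ⟨h0, h1', h2'⟩ := (KidaPelzHat.mem_box.mp h2 : _)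
    exact ⟨odd_of_mem_pmOne h0, odd_of_mem_pmOne h1', odd_of_mem_pmThree h2'⟩
  by_cases h3 : k ∈ KidaPelzHat.M3
  · obtain ⟨h0, h1', h2'⟩ := (KidaPelzHat.mem_box.mp h3 : _)
    exact ⟨odd_of_mem_pmThree h0, odd_of_mem_pmOne h1', odd_of_mem_pmOne h2'⟩
  · have hk : k ∉ KidaPelzHat.modes := by
      unfold KidaPelzHat.modes
      simp only [Finset.mem_union, not_or]
      exact ⟨⟨h1, h2⟩, h3⟩
    exact (h (funext fun j => KidaPelzHat.coeffFun_of_not_mem hk j)).elim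

/-- `τ_{(π,π,0)} tg = tg`. [folklore] -/
theorem translate_halfXY_tg : translate halfXY TaylorGreenHat.tg = TaylorGreenHat.tg :=
  translate_halfXY_eq_self_of_odd TaylorGreenHat.odd_of_coeff_ne_zero

/-- `τ_{(π,0,π)} tg = tg`. [folklore] -/
theorem translate_halfXZ_tg : translate halfXZ TaylorGreenHat.tg = TaylorGreenHat.tg :=
  translate_halfXZ_eq_self_of_odd TaylorGreenHat.odd_of_coeff_ne_zero

/-- `τ_{(π,π,0)} kp = kp`. [folklore] -/
theorem translate_halfXY_kp : translate halfXY KidaPelzHat.kp = KidaPelzHat.kp :=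
  translate_halfXY_eq_self_of_odd KidaPelzHat.odd_of_coeff_ne_zero

/-- `τ_{(π,0,π)} kp = kp`. [folklore] -/
theorem translate_halfXZ_kp : translate halfXZ KidaPelzHat.kp = KidaPelzHat.kp :=
  translate_halfXZ_eq_self_of_odd KidaPelzHat.odd_of_coeff_ne_zero

/-- **MIXED-PARITY MODES STAY EMPTY IN TAYLOR–GREEN RUNS.** Along every unforced Galerkin solution (any
`ν`, any pressure multiplier, any mode set `S`) supported in `S` and passing through the Taylor–Green datum
at some time, the coefficient of every wavevector of mixed parity vanishes at all times. [folklore] -/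
theorem tg_mixedParity_zero {U : ℝ → FourierVelocity} {S : Finset (Fin 3 → ℤ)} {ν : ℝ}
    {c : ℝ → (Fin 3 → ℤ) → ℂ} (hU : IsGalerkinSolution U S ν c fun _ _ _ => 0) (hs : IsSupportedOn U S)
    {t₀ : ℝ} (h0 : U t₀ = TaylorGreenHat.tg) (t : ℝ) {k : Fin 3 → ℤ} (hk : ¬UniformParity k) :
    (U t).coeff k = 0 :=
  coeff_eq_zero_of_not_uniformParity
    (translate_eq_self hU hs halfXY (by rw [h0, translate_halfXY_tg]) t)
    (translate_eq_self hU hs halfXZ (by rw [h0, translate_halfXZ_tg]) t) hk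

/-- **MIXED-PARITY MODES STAY EMPTY IN KIDA–PELZ RUNS.** [folklore] -/
theorem kp_mixedParity_zero {U : ℝ → FourierVelocity} {S : Finset (Fin 3 → ℤ)} {ν : ℝ}
    {c : ℝ → (Fin 3 → ℤ) → ℂ} (hU : IsGalerkinSolution U S ν c fun _ _ _ => 0) (hs : IsSupportedOn U S)
    {t₀ : ℝ} (h0 : U t₀ = KidaPelzHat.kp) (t : ℝ) {k : Fin 3 → ℤ} (hk : ¬UniformParity k) :
    (U t).coeff k = 0 :=
  coeff_eq_zero_of_not_uniformParity
    (translate_eq_self hU hs halfXY (by rw [h0, translate_halfXY_kp]) t)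
    (translate_eq_self hU hs halfXZ (by rw [h0, translate_halfXZ_kp]) t) hk

/-- Hence the mixed-parity modes carry no energy in such runs. [folklore] -/
theorem tg_modalEnergy_mixedParity {U : ℝ → FourierVelocity} {S : Finset (Fin 3 → ℤ)} {ν : ℝ}
    {c : ℝ → (Fin 3 → ℤ) → ℂ} (hU : IsGalerkinSolution U S ν c fun _ _ _ => 0) (hs : IsSupportedOn U S)
    {t₀ : ℝ} (h0 : U t₀ = TaylorGreenHat.tg) (t : ℝ) {k : Fin 3 → ℤ} (hk : ¬UniformParity k) :
    modalEnergy (U t) k = 0 :=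
  modalEnergy_eq_zero_of_coeff (U t) (tg_mixedParity_zero hU hs h0 t hk)

/-! ## Space-group elements: a point operation followed by a translation -/

namespace LatticeIsometry

variable (g : LatticeIsometry)

/-- **The space-group element `(M, a)`**, `x ↦ Mx + a`, acting on velocity fields: `u ↦ [x ↦ M u(Mᵀ(x − a))]`,
in Fourier space `û(k) ↦ e^{-ik·a} M û(Mᵀk)`. [folklore] -/
def sg (a : Fin 3 → ℝ) (A : FourierVelocity) : FourierVelocity := translate a (g.act A)

/-- Unfolding. [folklore] -/
theorem sg_def (a : Fin 3 → ℝ) (A : FourierVelocity) : g.sg a A = translate a (g.act A) := rfl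

/-- **Space-group elements map unforced Galerkin solutions to unforced Galerkin solutions** on a mode set
mapped into itself by `Mᵀ`. [cite: Frisch1995Turbulence, §2.2 p. 17] -/
theorem isGalerkinSolution_sg {U : ℝ → FourierVelocity} {S : Finset (Fin 3 → ℤ)} {ν : ℝ}
    {c : ℝ → (Fin 3 → ℤ) → ℂ} (hU : IsGalerkinSolution U S ν c fun _ _ _ => 0)
    (hS : ∀ p ∈ S, g.invK p ∈ S) (a : Fin 3 → ℝ) :
    IsGalerkinSolution (fun t => g.sg a (U t)) S ν (fun t k => phase a k * c t (g.invK k))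
      fun _ _ _ => 0 := by
  have hg := g.isGalerkinSolution_act hU hS
  have hf : (fun (t : ℝ) (k : Fin 3 → ℤ) =>
      g.actV ((fun (_ : ℝ) (_ : Fin 3 → ℤ) (_ : Fin 3) => (0 : ℂ)) t (g.invK k))) = fun _ _ _ => 0 := by
    funext t k
    exact g.actV_zero
  rw [hf] at hg
  exact isGalerkinSolution_translate_unforced hg a

/-- They preserve support in a mode set mapped into itself by `M`. [folklore] -/
theorem sg_isSupportedOn {U : ℝ → FourierVelocity} {S : Finset (Fin 3 → ℤ)} (hS' : ∀ p ∈ S, g.actK p ∈ S)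
    (hs : IsSupportedOn U S) (a : Fin 3 → ℝ) : IsSupportedOn (fun t => g.sg a (U t)) S :=
  translate_isSupportedOn a (g.act_isSupportedOn hS' hs)

/-- **PERSISTENCE OF A SPACE-GROUP SYMMETRY.** An unforced Galerkin solution supported in `S` (mapped into
itself by `M` and `Mᵀ`) whose datum is `(M,a)`-invariant at one time is `(M,a)`-invariant at every time.
[folklore] -/
theorem sg_eq_self {U : ℝ → FourierVelocity} {S : Finset (Fin 3 → ℤ)} {ν : ℝ} {c : ℝ → (Fin 3 → ℤ) → ℂ}
    (hU : IsGalerkinSolution U S ν c fun _ _ _ => 0) (hs : IsSupportedOn U S)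
    (hS : ∀ p ∈ S, g.invK p ∈ S) (hS' : ∀ p ∈ S, g.actK p ∈ S) (a : Fin 3 → ℝ) {t₀ : ℝ}
    (h0 : g.sg a (U t₀) = U t₀) (t : ℝ) : g.sg a (U t) = U t :=
  GalerkinODE.galerkin_unique S (g.isGalerkinSolution_sg hU hS a) hU (g.sg_isSupportedOn hS' hs a) hs h0 t

/-- `E[(M,a)·û](k) = E[û](Mᵀk)`. [folklore] -/
theorem modalEnergy_sg (a : Fin 3 → ℝ) (A : FourierVelocity) (k : Fin 3 → ℤ) :
    modalEnergy (g.sg a A) k = modalEnergy A (g.invK k) := by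
  rw [sg_def, modalEnergy_translate, modalEnergy_act]

/-- `E_S[(M,a)·û] = E_S[û]` on a mode set mapped into itself by `Mᵀ`. [folklore] -/
theorem truncEnergy_sg (a : Fin 3 → ℝ) (A : FourierVelocity) {S : Finset (Fin 3 → ℤ)}
    (hS : ∀ p ∈ S, g.invK p ∈ S) : truncEnergy (g.sg a A) S = truncEnergy A S := by
  rw [sg_def, truncEnergy_translate, g.truncEnergy_act A hS]

/-- `Z_S[(M,a)·û] = Z_S[û]` on a mode set mapped into itself by `Mᵀ`. [folklore] -/
theorem truncEnstrophy_sg (a : Fin 3 → ℝ) (A : FourierVelocity) {S : Finset (Fin 3 → ℤ)}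
    (hS : ∀ p ∈ S, g.invK p ∈ S) : truncEnstrophy (g.sg a A) S = truncEnstrophy A S := by
  rw [sg_def, truncEnstrophy_translate, g.truncEnstrophy_act A hS]

/-- The point-group action commutes with real scalings. [folklore] -/
theorem act_scale (r : ℝ) (A : FourierVelocity) :
    g.act (TaylorGreenHat.scale r A) = TaylorGreenHat.scale r (g.act A) := by
  refine TaylorGreenHat.fourierVelocity_ext ?_
  funext k i
  simp only [act_coeff, TaylorGreenHat.scale_coeff]
  rw [Finset.mul_sum]
  refine Finset.sum_congr rfl fun j _ => ?_
  ring

end LatticeIsometry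

/-- Translations commute with real scalings. [folklore] -/
theorem translate_scale (a : Fin 3 → ℝ) (r : ℝ) (A : FourierVelocity) :
    translate a (TaylorGreenHat.scale r A) = TaylorGreenHat.scale r (translate a A) := by
  refine TaylorGreenHat.fourierVelocity_ext ?_
  funext k i
  rw [translate_coeff, TaylorGreenHat.scale_coeff, TaylorGreenHat.scale_coeff, translate_coeff]
  ring

/-- `(-1)·((-1)·û) = û`. [folklore] -/
theorem scale_neg_one_scale_neg_one (A : FourierVelocity) :
    TaylorGreenHat.scale (-1) (TaylorGreenHat.scale (-1) A) = A := by
  refine TaylorGreenHat.fourierVelocity_ext ?_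
  funext k i
  rw [TaylorGreenHat.scale_coeff, TaylorGreenHat.scale_coeff]
  push_cast
  ring

/-! ## The half-period translation along `x` reverses both data; the quarter turn about `x = y = π/2` -/

/-- A field supported on wavevectors with odd first entry is REVERSED by the translation by `(π,0,0)`.
[folklore] -/
theorem translate_halfX_eq_neg_of_odd {A : FourierVelocity} (hA : ∀ k, A.coeff k ≠ 0 → Odd (k 0)) :
    translate halfX A = TaylorGreenHat.scale (-1) A := by
  refine TaylorGreenHat.fourierVelocity_ext ?_
  funext k j
  rw [translate_coeff, TaylorGreenHat.scale_coeff]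
  by_cases hk : A.coeff k = 0
  · simp [hk]
  · rw [phase_eq_neg_one_of_odd (rdot_halfX k) (hA k hk)]
    push_cast
    ring

/-- `τ_{(π,0,0)} tg = -tg`. [folklore] -/
theorem translate_halfX_tg : translate halfX TaylorGreenHat.tg = TaylorGreenHat.scale (-1) TaylorGreenHat.tg :=
  translate_halfX_eq_neg_of_odd fun k h => (TaylorGreenHat.odd_of_coeff_ne_zero k h).1

/-- `τ_{(π,0,0)} kp = -kp`. [folklore] -/
theorem translate_halfX_kp : translate halfX KidaPelzHat.kp = TaylorGreenHat.scale (-1) KidaPelzHat.kp :=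
  translate_halfX_eq_neg_of_odd fun k h => (KidaPelzHat.odd_of_coeff_ne_zero k h).1

/-- **THE TAYLOR–GREEN VORTEX IS INVARIANT UNDER THE ROTATION BY `π/2` ABOUT THE AXIS `x = y = π/2`**
(`x ↦ rotZ·x + (π,0,0) = (π − y, x, z)`): `(rotZ, (π,0,0)) · tg = tg`. This is the rotational symmetry
"of `π/2` around the third axis `x = y = π/2`" of the Taylor–Green literature, with its consequence
`v_y(x,y,z) = −v_x(π−y,x,z)` [cite: LeeEtAl2008TGMHD, §II (arXiv p. 4)] — while the quarter turn about the
`z`-axis THROUGH THE ORIGIN reverses the datum (`rotZ_act_tg`). [folklore] -/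
theorem rotZ_sg_halfX_tg : rotZ.sg halfX TaylorGreenHat.tg = TaylorGreenHat.tg := by
  rw [LatticeIsometry.sg_def, rotZ_act_tg, translate_scale, translate_halfX_tg, scale_neg_one_scale_neg_one]

/-- `(swapXY, (π,0,0)) · tg = tg`: the diagonal reflection `x ↔ y` followed by the half-period shift along
`x`. [folklore] -/
theorem swapXY_sg_halfX_tg : swapXY.sg halfX TaylorGreenHat.tg = TaylorGreenHat.tg := by
  rw [LatticeIsometry.sg_def, swapXY_act_tg, translate_scale, translate_halfX_tg, scale_neg_one_scale_neg_one]

/-- `(swapXY, (π,0,0)) · kp = kp`. [folklore] -/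
theorem swapXY_sg_halfX_kp : swapXY.sg halfX KidaPelzHat.kp = KidaPelzHat.kp := by
  rw [LatticeIsometry.sg_def, KidaPelzHat.swapXY_act_kp, translate_scale, translate_halfX_kp,
    scale_neg_one_scale_neg_one]

namespace KidaPelzHat

/-- Box membership of the vector `(k₁, -k₀, k₂)` (the `rotZ` pre-image) when the factors are symmetric.
[folklore] -/
theorem rotZ_vec_mem_box_iff {A B C : Finset ℤ} (hB : ∀ a : ℤ, -a ∈ B ↔ a ∈ B) (k : Fin 3 → ℤ) :
    (![k 1, -k 0, k 2] : Fin 3 → ℤ) ∈ box A B C ↔ k ∈ box B A C := by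
  rw [mem_box, mem_box]
  simp only [Matrix.cons_val_zero, Matrix.cons_val_one, Matrix.head_cons, Matrix.cons_val_two,
    Matrix.tail_cons, hB]
  constructor
  · rintro ⟨h1, h0, h2⟩; exact ⟨h0, h1, h2⟩
  · rintro ⟨h0, h1, h2⟩; exact ⟨h1, h0, h2⟩

/-- **`rotZ · kp = -kp`**: the quarter turn about the `z`-axis through the origin reverses the Kida–Pelz
datum. [folklore] -/
theorem rotZ_act_kp : rotZ.act kp = TaylorGreenHat.scale (-1) kp := by
  refine TaylorGreenHat.fourierVelocity_ext ?_
  funext k i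
  rw [LatticeIsometry.act_coeff, rotZ_invK, TaylorGreenHat.scale_coeff]
  have h1 : (![k 1, -k 0, k 2] : Fin 3 → ℤ) ∈ M1 ↔ k ∈ M3 := by
    rw [M1, rotZ_vec_mem_box_iff (fun a => neg_mem_pmThree_iff), M3]
  have h2 : (![k 1, -k 0, k 2] : Fin 3 → ℤ) ∈ M2 ↔ k ∈ M2 := by
    rw [M2, rotZ_vec_mem_box_iff (fun a => neg_mem_pmOne_iff)]
  have h3 : (![k 1, -k 0, k 2] : Fin 3 → ℤ) ∈ M3 ↔ k ∈ M1 := by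
    rw [M3, rotZ_vec_mem_box_iff (fun a => neg_mem_pmOne_iff), M1]
  simp only [coeff_cases, h1, h2, h3]
  by_cases hk1 : k ∈ M1
  · have hk2 : k ∉ M2 := fun h => not_mem_M1_of_mem_M2 h hk1
    have hk3 : k ∉ M3 := fun h => not_mem_M1_of_mem_M3 h hk1
    simp only [if_pos hk1, if_neg hk2, if_neg hk3]
    unfold rotZ
    fin_cases i <;> simp [Fin.sum_univ_three, neg_div]
  by_cases hk2 : k ∈ M2
  · have hk3 : k ∉ M3 := fun h => not_mem_M2_of_mem_M3 h hk2
    simp only [if_neg hk1, if_pos hk2, if_neg hk3]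
    unfold rotZ
    fin_cases i <;> simp [Fin.sum_univ_three, neg_div]
  by_cases hk3 : k ∈ M3
  · simp only [if_neg hk1, if_neg hk2, if_pos hk3]
    unfold rotZ
    fin_cases i <;> simp [Fin.sum_univ_three, neg_div]
  · simp only [if_neg hk1, if_neg hk2, if_neg hk3, mul_zero, Finset.sum_const_zero]

/-- **THE KIDA–PELZ FLOW IS INVARIANT UNDER THE ROTATION BY `π/2` ABOUT THE AXIS `x = y = π/2`**:
`(rotZ, (π,0,0)) · kp = kp` — it "has all the symmetries of the TG vortex"
[cite: CichowlasBrachet2005, p. 240]; by `cycleXYZ_act_kp` the quarter turns about the other two such axes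
follow. [folklore] -/
theorem rotZ_sg_halfX_kp : rotZ.sg halfX kp = kp := by
  rw [LatticeIsometry.sg_def, rotZ_act_kp, translate_scale, translate_halfX_kp, scale_neg_one_scale_neg_one]

end KidaPelzHat

/-- **PERSISTENCE OF THE QUARTER-TURN SYMMETRY IN TAYLOR–GREEN RUNS.** Every unforced Galerkin solution (any
`ν`, any pressure multiplier) supported in a mode set mapped into itself by `rotZ` and passing through the
Taylor–Green datum at some time is invariant under the rotation by `π/2` about `x = y = π/2` at all times.
[folklore] -/
theorem tg_rotZ_sg_persists {U : ℝ → FourierVelocity} {S : Finset (Fin 3 → ℤ)} {ν : ℝ}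
    {c : ℝ → (Fin 3 → ℤ) → ℂ} (hU : IsGalerkinSolution U S ν c fun _ _ _ => 0) (hs : IsSupportedOn U S)
    (hS : ∀ p ∈ S, rotZ.invK p ∈ S) (hS' : ∀ p ∈ S, rotZ.actK p ∈ S) {t₀ : ℝ} (h0 : U t₀ = TaylorGreenHat.tg)
    (t : ℝ) : rotZ.sg halfX (U t) = U t :=
  rotZ.sg_eq_self hU hs hS hS' halfX (by rw [h0, rotZ_sg_halfX_tg]) t

/-- **PERSISTENCE OF THE QUARTER-TURN SYMMETRY IN KIDA–PELZ RUNS.** [folklore] -/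
theorem kp_rotZ_sg_persists {U : ℝ → FourierVelocity} {S : Finset (Fin 3 → ℤ)} {ν : ℝ}
    {c : ℝ → (Fin 3 → ℤ) → ℂ} (hU : IsGalerkinSolution U S ν c fun _ _ _ => 0) (hs : IsSupportedOn U S)
    (hS : ∀ p ∈ S, rotZ.invK p ∈ S) (hS' : ∀ p ∈ S, rotZ.actK p ∈ S) {t₀ : ℝ} (h0 : U t₀ = KidaPelzHat.kp)
    (t : ℝ) : rotZ.sg halfX (U t) = U t :=
  rotZ.sg_eq_self hU hs hS hS' halfX (by rw [h0, KidaPelzHat.rotZ_sg_halfX_kp]) t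

/-- **PERSISTENCE OF THE DIAGONAL-REFLECTION SYMMETRY IN TAYLOR–GREEN RUNS.** [folklore] -/
theorem tg_swapXY_sg_persists {U : ℝ → FourierVelocity} {S : Finset (Fin 3 → ℤ)} {ν : ℝ}
    {c : ℝ → (Fin 3 → ℤ) → ℂ} (hU : IsGalerkinSolution U S ν c fun _ _ _ => 0) (hs : IsSupportedOn U S)
    (hS : ∀ p ∈ S, swapXY.invK p ∈ S) (hS' : ∀ p ∈ S, swapXY.actK p ∈ S) {t₀ : ℝ}
    (h0 : U t₀ = TaylorGreenHat.tg) (t : ℝ) : swapXY.sg halfX (U t) = U t :=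
  swapXY.sg_eq_self hU hs hS hS' halfX (by rw [h0, swapXY_sg_halfX_tg]) t

/-! ## The printed Taylor–Green symmetry list, completed: the rotations by `π` about `x = z = π/2` and `y = z = π/2`

[cite: LeeEtAl2008TGMHD, §II (arXiv p. 4)]: "there are two planes of mirror symmetries (or anti-symmetries) in each
dimension: `x=0,π`; `y=0,π`; and `z=0,π`" (on the `2π`-torus the reflections in `x = 0` and in `x = π` are the
same map: `reflX`, `reflY`, `reflZ` of LatticeSymmetry, all fixing `tg`), "the flow is also invariant by rotation
of `π` around the two axis `x=z=π/2` and `y=z=π/2`" (`x ↦ diag(−1,1,−1)x + (π,0,π)`, `x ↦ diag(1,−1,−1)x + (0,π,π)`: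
`rotYpi_sg_halfXZ_tg`, `rotXpi_sg_halfYZ_tg` below) "and by rotation of `π/2` around the third axis `x=y=π/2`"
(`rotZ_sg_halfX_tg` above). The Kida–Pelz datum has the same invariances (`…_kp`). -/

/-- The half-diagonal of the `yz` face: `a = (0, π, π)`. [folklore] -/
def halfYZ : Fin 3 → ℝ := ![0, Real.pi, Real.pi]

/-- `k·(0,π,π) = (k₁+k₂)π`. [folklore] -/
theorem rdot_halfYZ (k : Fin 3 → ℤ) : rdot k halfYZ = ((k 1 + k 2 : ℤ) : ℝ) * Real.pi := by
  unfold rdot halfYZ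
  simp [Fin.sum_univ_three]
  ring

/-- A field supported on wavevectors with all entries odd is invariant under the translation by `(0,π,π)`.
[folklore] -/
theorem translate_halfYZ_eq_self_of_odd {A : FourierVelocity}
    (hA : ∀ k, A.coeff k ≠ 0 → Odd (k 0) ∧ Odd (k 1) ∧ Odd (k 2)) : translate halfYZ A = A := by
  refine TaylorGreenHat.fourierVelocity_ext ?_
  funext k j
  rw [translate_coeff]
  by_cases hk : A.coeff k = 0
  · simp [hk]
  · obtain ⟨-, h1, h2⟩ := hA k hk
    rw [phase_eq_one_of_even (rdot_halfYZ k) (h1.add_odd h2), one_mul]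

/-- `τ_{(0,π,π)} tg = tg`. [folklore] -/
theorem translate_halfYZ_tg : translate halfYZ TaylorGreenHat.tg = TaylorGreenHat.tg :=
  translate_halfYZ_eq_self_of_odd TaylorGreenHat.odd_of_coeff_ne_zero

/-- `τ_{(0,π,π)} kp = kp`. [folklore] -/
theorem translate_halfYZ_kp : translate halfYZ KidaPelzHat.kp = KidaPelzHat.kp :=
  translate_halfYZ_eq_self_of_odd KidaPelzHat.odd_of_coeff_ne_zero

/-- Rotation by `π` about the `y`-axis: `(x, y, z) ↦ (-x, y, -z)`. [folklore] -/
def rotYpi : LatticeIsometry where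
  M := ![![-1, 0, 0], ![0, 1, 0], ![0, 0, -1]]
  orth_col j l := by
    fin_cases j <;> fin_cases l <;> simp [Fin.sum_univ_three]
  orth_row j l := by
    fin_cases j <;> fin_cases l <;> simp [Fin.sum_univ_three]

/-- Rotation by `π` about the `x`-axis: `(x, y, z) ↦ (x, -y, -z)`. [folklore] -/
def rotXpi : LatticeIsometry where
  M := ![![1, 0, 0], ![0, -1, 0], ![0, 0, -1]]
  orth_col j l := by
    fin_cases j <;> fin_cases l <;> simp [Fin.sum_univ_three]
  orth_row j l := by
    fin_cases j <;> fin_cases l <;> simp [Fin.sum_univ_three]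

/-- `rotYpi`: `Mᵀk = (-k₀, k₁, -k₂)`. [folklore] -/
theorem rotYpi_invK (k : Fin 3 → ℤ) : rotYpi.invK k = ![-k 0, k 1, -k 2] := by
  funext i
  unfold LatticeIsometry.invK rotYpi
  fin_cases i <;> simp [Fin.sum_univ_three]

/-- `rotXpi`: `Mᵀk = (k₀, -k₁, -k₂)`. [folklore] -/
theorem rotXpi_invK (k : Fin 3 → ℤ) : rotXpi.invK k = ![k 0, -k 1, -k 2] := by
  funext i
  unfold LatticeIsometry.invK rotXpi
  fin_cases i <;> simp [Fin.sum_univ_three]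

/-- `rotYpi · A = reflX · (reflZ · A)` coefficientwise. [folklore] -/
theorem rotYpi_act_eq (A : FourierVelocity) : rotYpi.act A = reflX.act (reflZ.act A) := by
  refine TaylorGreenHat.fourierVelocity_ext ?_
  funext k i
  rw [LatticeIsometry.act_coeff, rotYpi_invK, LatticeIsometry.act_coeff, reflX_invK]
  simp only [LatticeIsometry.act_coeff, reflZ_invK]
  unfold rotYpi reflX reflZ
  fin_cases i <;> simp [Fin.sum_univ_three]

/-- `rotXpi · A = reflY · (reflZ · A)` coefficientwise. [folklore] -/
theorem rotXpi_act_eq (A : FourierVelocity) : rotXpi.act A = reflY.act (reflZ.act A) := by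
  refine TaylorGreenHat.fourierVelocity_ext ?_
  funext k i
  rw [LatticeIsometry.act_coeff, rotXpi_invK, LatticeIsometry.act_coeff, reflY_invK]
  simp only [LatticeIsometry.act_coeff, reflZ_invK]
  unfold rotXpi reflY reflZ
  fin_cases i <;> simp [Fin.sum_univ_three]

/-- **TG is invariant under the rotation by `π` about the axis `x = z = π/2`** (`x ↦ rotYpi·x + (π,0,π) =
(π−x, y, π−z)`). [cite: LeeEtAl2008TGMHD, §II (arXiv p. 4)] -/
theorem rotYpi_sg_halfXZ_tg : rotYpi.sg halfXZ TaylorGreenHat.tg = TaylorGreenHat.tg := by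
  rw [LatticeIsometry.sg_def, rotYpi_act_eq, reflZ_act_tg, reflX_act_tg, translate_halfXZ_tg]

/-- **TG is invariant under the rotation by `π` about the axis `y = z = π/2`** (`x ↦ rotXpi·x + (0,π,π) =
(x, π−y, π−z)`). [cite: LeeEtAl2008TGMHD, §II (arXiv p. 4)] -/
theorem rotXpi_sg_halfYZ_tg : rotXpi.sg halfYZ TaylorGreenHat.tg = TaylorGreenHat.tg := by
  rw [LatticeIsometry.sg_def, rotXpi_act_eq, reflZ_act_tg, reflY_act_tg, translate_halfYZ_tg]

/-- The Kida–Pelz datum has the same two invariances. [cite: CichowlasBrachet2005, p. 240] -/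
theorem rotYpi_sg_halfXZ_kp : rotYpi.sg halfXZ KidaPelzHat.kp = KidaPelzHat.kp := by
  rw [LatticeIsometry.sg_def, rotYpi_act_eq, KidaPelzHat.reflZ_act_kp, KidaPelzHat.reflX_act_kp,
    translate_halfXZ_kp]

/-- … and `y = z = π/2`. [cite: CichowlasBrachet2005, p. 240] -/
theorem rotXpi_sg_halfYZ_kp : rotXpi.sg halfYZ KidaPelzHat.kp = KidaPelzHat.kp := by
  rw [LatticeIsometry.sg_def, rotXpi_act_eq, KidaPelzHat.reflZ_act_kp, KidaPelzHat.reflY_act_kp,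
    translate_halfYZ_kp]

/-! ## The modal energy distribution of a Taylor–Green / Kida–Pelz run keeps the symmetry of the datum -/

namespace LatticeIsometry

/-- A `g`-invariant field has a `g`-invariant modal energy distribution: `E(Mᵀk) = E(k)`. [folklore] -/
theorem modalEnergy_invK_of_act_eq (g : LatticeIsometry) {A : FourierVelocity} (h : g.act A = A)
    (k : Fin 3 → ℤ) : modalEnergy A (g.invK k) = modalEnergy A k := by
  rw [← g.modalEnergy_act A k, h]

end LatticeIsometry

/-- **Kida–Pelz runs: `E(k₁,k₂,k₀; t) = E(k₀,k₁,k₂; t)`** — the modal energies are invariant under the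
coordinate 3-cycle at all times (a free spectral symmetry diagnostic of CL-kp rows). [folklore] -/
theorem kp_modalEnergy_cycle {U : ℝ → FourierVelocity} {S : Finset (Fin 3 → ℤ)} {ν : ℝ}
    {c : ℝ → (Fin 3 → ℤ) → ℂ} (hU : IsGalerkinSolution U S ν c fun _ _ _ => 0) (hs : IsSupportedOn U S)
    (hS : ∀ p ∈ S, cycleXYZ.invK p ∈ S) (hS' : ∀ p ∈ S, cycleXYZ.actK p ∈ S) {t₀ : ℝ}
    (h0 : U t₀ = KidaPelzHat.kp) (t : ℝ) (k : Fin 3 → ℤ) :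
    modalEnergy (U t) ![k 1, k 2, k 0] = modalEnergy (U t) k := by
  have h := cycleXYZ.modalEnergy_invK_of_act_eq (KidaPelzHat.kp_cycleXYZ_persists hU hs hS hS' h0 t) k
  rwa [cycleXYZ_invK] at h

/-- **Kida–Pelz runs: `E(−k₀,k₁,k₂; t) = E(k₀,k₁,k₂; t)`** (mirror symmetry of the spectrum). [folklore] -/
theorem kp_modalEnergy_reflX {U : ℝ → FourierVelocity} {S : Finset (Fin 3 → ℤ)} {ν : ℝ}
    {c : ℝ → (Fin 3 → ℤ) → ℂ} (hU : IsGalerkinSolution U S ν c fun _ _ _ => 0) (hs : IsSupportedOn U S)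
    (hS : ∀ p ∈ S, reflX.invK p ∈ S) (hS' : ∀ p ∈ S, reflX.actK p ∈ S) {t₀ : ℝ}
    (h0 : U t₀ = KidaPelzHat.kp) (t : ℝ) (k : Fin 3 → ℤ) :
    modalEnergy (U t) ![-k 0, k 1, k 2] = modalEnergy (U t) k := by
  have h := reflX.modalEnergy_invK_of_act_eq (KidaPelzHat.kp_reflX_persists hU hs hS hS' h0 t) k
  rwa [reflX_invK] at h

/-- **Taylor–Green runs: `E(−k₀,k₁,k₂; t) = E(k₀,k₁,k₂; t)`.** [folklore] -/
theorem tg_modalEnergy_reflX {U : ℝ → FourierVelocity} {S : Finset (Fin 3 → ℤ)} {ν : ℝ}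
    {c : ℝ → (Fin 3 → ℤ) → ℂ} (hU : IsGalerkinSolution U S ν c fun _ _ _ => 0) (hs : IsSupportedOn U S)
    (hS : ∀ p ∈ S, reflX.invK p ∈ S) (hS' : ∀ p ∈ S, reflX.actK p ∈ S) {t₀ : ℝ}
    (h0 : U t₀ = TaylorGreenHat.tg) (t : ℝ) (k : Fin 3 → ℤ) :
    modalEnergy (U t) ![-k 0, k 1, k 2] = modalEnergy (U t) k := by
  have h := reflX.modalEnergy_invK_of_act_eq (tg_reflX_persists hU hs hS hS' h0 t) k
  rwa [reflX_invK] at h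

/-- **Taylor–Green runs under the quarter turn about `x = y = π/2`: `E(k₁,−k₀,k₂; t) = E(k₀,k₁,k₂; t)`**
(the translation part does not change modal energies). [folklore] -/
theorem tg_modalEnergy_rotZ {U : ℝ → FourierVelocity} {S : Finset (Fin 3 → ℤ)} {ν : ℝ}
    {c : ℝ → (Fin 3 → ℤ) → ℂ} (hU : IsGalerkinSolution U S ν c fun _ _ _ => 0) (hs : IsSupportedOn U S)
    (hS : ∀ p ∈ S, rotZ.invK p ∈ S) (hS' : ∀ p ∈ S, rotZ.actK p ∈ S) {t₀ : ℝ}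
    (h0 : U t₀ = TaylorGreenHat.tg) (t : ℝ) (k : Fin 3 → ℤ) :
    modalEnergy (U t) ![k 1, -k 0, k 2] = modalEnergy (U t) k := by
  have h := tg_rotZ_sg_persists hU hs hS hS' h0 t
  have e := rotZ.modalEnergy_sg halfX (U t) k
  rw [h, rotZ_invK] at e
  exact e.symm

/-! ## A persisting mirror symmetry kills the helicity: `H_S ≡ 0` along Taylor–Green and Kida–Pelz runs

Helicity is a pseudoscalar: under the reflection `x ↦ −x`, `H(k) ↦ −H(Mᵀk)` (`modalHelicity_reflX_act`), so a
`reflX`-invariant field has `H_S = 0` on every `reflX`-invariant mode set; since the mirror symmetry of both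
classical data persists (`tg_reflX_persists`, `KidaPelzHat.kp_reflX_persists`), **the truncated helicity of every
TG / KP Galerkin run (any `ν`, any pressure multiplier) is identically zero** — the helicity column of such rows
is pure round-off (cf. the realizability bound `abs(H_S) ≤ 2√(E_S Z_S)` of EnergyParseval, which is far from
saturated here). [folklore] -/

/-- The coefficients of `reflX · A`: `(−û₀, û₁, û₂)(−k₀, k₁, k₂)`. [folklore] -/
theorem reflX_act_coeff_eq (A : FourierVelocity) (k : Fin 3 → ℤ) :
    (reflX.act A).coeff k =
      ![-(A.coeff (reflX.invK k) 0), A.coeff (reflX.invK k) 1, A.coeff (reflX.invK k) 2] := by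
  funext i
  rw [LatticeIsometry.act_coeff]
  unfold reflX
  fin_cases i <;> simp [Fin.sum_univ_three]

/-- **Helicity is odd under the mirror `x ↦ −x`**: `H[reflX·û](k) = −H[û](Mᵀk)`. [folklore] -/
theorem modalHelicity_reflX_act (A : FourierVelocity) (k : Fin 3 → ℤ) :
    modalHelicity (reflX.act A) k = -modalHelicity A (reflX.invK k) := by
  unfold modalHelicity
  rw [← Complex.neg_re]
  congr 1
  have hb : ∀ j, (reflX.act A).coeff k j =
      (![-(A.coeff (reflX.invK k) 0), A.coeff (reflX.invK k) 1, A.coeff (reflX.invK k) 2] : Fin 3 → ℂ) j :=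
    fun j => congrFun (reflX_act_coeff_eq A k) j
  have hk : ∀ i, reflX.invK k i = (![-k 0, k 1, k 2] : Fin 3 → ℤ) i := fun i => congrFun (reflX_invK k) i
  simp only [Fin.sum_univ_three, curl_coeff, kcross_zero, kcross_one, kcross_two, hb, hk, map_mul, Complex.conj_I,
    map_sub, map_intCast, map_neg, Matrix.cons_val_zero, Matrix.cons_val_one, Matrix.head_cons, Matrix.cons_val_two,
    Matrix.tail_cons, Int.cast_neg]
  ring

/-- Hence `H_S[reflX·û] = −H_S[û]` on a `reflX`-invariant mode set. [folklore] -/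
theorem truncHelicity_reflX_act (A : FourierVelocity) {S : Finset (Fin 3 → ℤ)}
    (hS : ∀ p ∈ S, reflX.invK p ∈ S) : truncHelicity (reflX.act A) S = -truncHelicity A S := by
  unfold truncHelicity
  rw [Finset.sum_congr rfl fun k _ => modalHelicity_reflX_act A k, Finset.sum_neg_distrib,
    reflX.sum_comp_invK hS (fun q => modalHelicity A q)]

/-- **A mirror-symmetric field has zero helicity** (on a mirror-symmetric mode set). [folklore] -/
theorem truncHelicity_eq_zero_of_reflX {A : FourierVelocity} {S : Finset (Fin 3 → ℤ)} (h : reflX.act A = A)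
    (hS : ∀ p ∈ S, reflX.invK p ∈ S) : truncHelicity A S = 0 := by
  have e := truncHelicity_reflX_act A hS
  rw [h] at e
  linarith

/-- **`H_S(t) = 0` ALONG EVERY TAYLOR–GREEN RUN** (any `ν`, any pressure multiplier; `S` mapped into itself by
`reflX`). [folklore] -/
theorem tg_truncHelicity_zero {U : ℝ → FourierVelocity} {S : Finset (Fin 3 → ℤ)} {ν : ℝ}
    {c : ℝ → (Fin 3 → ℤ) → ℂ} (hU : IsGalerkinSolution U S ν c fun _ _ _ => 0) (hs : IsSupportedOn U S)
    (hS : ∀ p ∈ S, reflX.invK p ∈ S) (hS' : ∀ p ∈ S, reflX.actK p ∈ S) {t₀ : ℝ} (h0 : U t₀ = TaylorGreenHat.tg)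
    (t : ℝ) : truncHelicity (U t) S = 0 :=
  truncHelicity_eq_zero_of_reflX (tg_reflX_persists hU hs hS hS' h0 t) hS

/-- **`H_S(t) = 0` ALONG EVERY KIDA–PELZ RUN.** [folklore] -/
theorem kp_truncHelicity_zero {U : ℝ → FourierVelocity} {S : Finset (Fin 3 → ℤ)} {ν : ℝ}
    {c : ℝ → (Fin 3 → ℤ) → ℂ} (hU : IsGalerkinSolution U S ν c fun _ _ _ => 0) (hs : IsSupportedOn U S)
    (hS : ∀ p ∈ S, reflX.invK p ∈ S) (hS' : ∀ p ∈ S, reflX.actK p ∈ S) {t₀ : ℝ} (h0 : U t₀ = KidaPelzHat.kp)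
    (t : ℝ) : truncHelicity (U t) S = 0 :=
  truncHelicity_eq_zero_of_reflX (KidaPelzHat.kp_reflX_persists hU hs hS hS' h0 t) hS

/-! ## Time reversal composed with the body-diagonal half translation: the inviscid TG/KP runs are even in time

All carried wavevectors of `tg` and `kp` have three odd entries, so `k₀ + k₁ + k₂` is odd and the
translation by `(π,π,π)` REVERSES both data (`translate_halfXYZ_tg/_kp`). For the unforced truncated EULER
system `t ↦ −û(−t)` is again a solution (`TimeReversal.isGalerkinSolution_reverse`) with the same datum
`−û(0)`; by uniqueness **`û(k, t)·e^{-ik·(π,π,π)} = −û(k, −t)`** along every inviscid Taylor–Green or Kida–Pelz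
run (`tg_translate_halfXYZ_eq_reverse`, `kp_…`). Consequences, exact in the system stepped: every modal
energy is an EVEN function of time (`tg_modalEnergy_even`: `E(k,−t) = E(k,t)`; hence `E_K`, `Z_S`, the
spectra), every mode-to-mode / shell-to-shell transfer is ODD (`tg_modeTransfer_odd`, `tg_shellTransfer_odd`):
the Taylor series of `Z_S(t)` at `t = 0` has only even powers and that of `Π(k,t)` only odd ones (cf.
Taylor & Green's inviscid series, `TaylorGreenCurvature`). [folklore] -/

/-- The body-diagonal half translation `(π, π, π)`. [folklore] -/
def halfXYZ : Fin 3 → ℝ := ![Real.pi, Real.pi, Real.pi]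

/-- `k·(π,π,π) = (k₀+k₁+k₂)π`. [folklore] -/
theorem rdot_halfXYZ (k : Fin 3 → ℤ) : rdot k halfXYZ = ((k 0 + k 1 + k 2 : ℤ) : ℝ) * Real.pi := by
  unfold rdot halfXYZ
  simp [Fin.sum_univ_three]
  ring

/-- A field carried by all-odd wavevectors is REVERSED by the translation by `(π,π,π)`. [folklore] -/
theorem translate_halfXYZ_eq_neg_of_odd {A : FourierVelocity}
    (hA : ∀ k, A.coeff k ≠ 0 → Odd (k 0) ∧ Odd (k 1) ∧ Odd (k 2)) :
    translate halfXYZ A = TaylorGreenHat.scale (-1) A := by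
  refine TaylorGreenHat.fourierVelocity_ext ?_
  funext k j
  rw [translate_coeff, TaylorGreenHat.scale_coeff]
  by_cases hk : A.coeff k = 0
  · simp [hk]
  · obtain ⟨h0, h1, h2⟩ := hA k hk
    rw [phase_eq_neg_one_of_odd (rdot_halfXYZ k) ((h0.add_odd h1).add_odd h2)]
    push_cast
    ring

/-- `τ_{(π,π,π)} tg = -tg`. [folklore] -/
theorem translate_halfXYZ_tg :
    translate halfXYZ TaylorGreenHat.tg = TaylorGreenHat.scale (-1) TaylorGreenHat.tg :=
  translate_halfXYZ_eq_neg_of_odd TaylorGreenHat.odd_of_coeff_ne_zero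

/-- `τ_{(π,π,π)} kp = -kp`. [folklore] -/
theorem translate_halfXYZ_kp :
    translate halfXYZ KidaPelzHat.kp = TaylorGreenHat.scale (-1) KidaPelzHat.kp :=
  translate_halfXYZ_eq_neg_of_odd KidaPelzHat.odd_of_coeff_ne_zero

/-- Reversal preserves modal energies at mirrored times. [folklore] -/
theorem modalEnergy_reverse (U : ℝ → FourierVelocity) (t : ℝ) (k : Fin 3 → ℤ) :
    modalEnergy (reverse U t) k = modalEnergy (U (-t)) k := by
  unfold modalEnergy
  congr 1
  refine Finset.sum_congr rfl fun j _ => ?_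
  rw [reverse_coeff, Complex.normSq_neg]

/-- Real scalings act cubically on the mode-to-mode transfer. [folklore] -/
theorem modeTransfer_scale (r : ℝ) (A : FourierVelocity) (k p : Fin 3 → ℤ) :
    modeTransfer (TaylorGreenHat.scale r A) k p = r ^ 3 * modeTransfer A k p := by
  unfold modeTransfer
  have hk : kdot k ((TaylorGreenHat.scale r A).coeff (k - p)) = (r : ℂ) * kdot k (A.coeff (k - p)) := by
    unfold kdot
    rw [Finset.mul_sum]
    refine Finset.sum_congr rfl fun i _ => ?_
    simp only [TaylorGreenHat.scale_coeff]
    ring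
  have hc : cdot (fun i => conj ((TaylorGreenHat.scale r A).coeff k i)) ((TaylorGreenHat.scale r A).coeff p) =
      ((r : ℂ) * (r : ℂ)) * cdot (fun i => conj (A.coeff k i)) (A.coeff p) := by
    unfold cdot
    rw [Finset.mul_sum]
    refine Finset.sum_congr rfl fun i _ => ?_
    simp only [TaylorGreenHat.scale_coeff, map_mul, Complex.conj_ofReal]
    ring
  rw [hk, hc]
  have e : (r : ℂ) * kdot k (A.coeff (k - p)) * ((r : ℂ) * (r : ℂ) * cdot (fun i => conj (A.coeff k i)) (A.coeff p)) =
      ((r ^ 3 : ℝ) : ℂ) * (kdot k (A.coeff (k - p)) * cdot (fun i => conj (A.coeff k i)) (A.coeff p)) := by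
    push_cast
    ring
  rw [e, Complex.im_ofReal_mul]

/-- Reversal flips the sign of every mode-to-mode transfer at mirrored times. [folklore] -/
theorem modeTransfer_reverse (U : ℝ → FourierVelocity) (t : ℝ) (k p : Fin 3 → ℤ) :
    modeTransfer (reverse U t) k p = -modeTransfer (U (-t)) k p := by
  unfold reverse
  rw [modeTransfer_scale]
  ring

/-- **`τ_{(π,π,π)} û(t) = −û(−t)` ALONG INVISCID TAYLOR–GREEN RUNS**: an unforced Euler–Galerkin solution
(any pressure multiplier) supported in `S` with `û(0) = tg` satisfies `translate halfXYZ (U t) = reverse U t`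
for all `t` (translation covariance, time reversibility and `galerkin_unique`). [folklore] -/
theorem tg_translate_halfXYZ_eq_reverse {U : ℝ → FourierVelocity} {S : Finset (Fin 3 → ℤ)}
    {c : ℝ → (Fin 3 → ℤ) → ℂ} (hU : IsGalerkinSolution U S 0 c fun _ _ _ => 0) (hs : IsSupportedOn U S)
    (h0 : U 0 = TaylorGreenHat.tg) (t : ℝ) : translate halfXYZ (U t) = reverse U t := by
  refine GalerkinODE.galerkin_unique S (isGalerkinSolution_translate_unforced hU halfXYZ)
    (isGalerkinSolution_reverse hU) (translate_isSupportedOn halfXYZ hs) (reverse_isSupportedOn hs)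
    (t₀ := 0) ?_ t
  show translate halfXYZ (U 0) = reverse U 0
  unfold reverse
  rw [neg_zero, h0, translate_halfXYZ_tg]

/-- The same along inviscid Kida–Pelz runs. [folklore] -/
theorem kp_translate_halfXYZ_eq_reverse {U : ℝ → FourierVelocity} {S : Finset (Fin 3 → ℤ)}
    {c : ℝ → (Fin 3 → ℤ) → ℂ} (hU : IsGalerkinSolution U S 0 c fun _ _ _ => 0) (hs : IsSupportedOn U S)
    (h0 : U 0 = KidaPelzHat.kp) (t : ℝ) : translate halfXYZ (U t) = reverse U t := by
  refine GalerkinODE.galerkin_unique S (isGalerkinSolution_translate_unforced hU halfXYZ)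
    (isGalerkinSolution_reverse hU) (translate_isSupportedOn halfXYZ hs) (reverse_isSupportedOn hs)
    (t₀ := 0) ?_ t
  show translate halfXYZ (U 0) = reverse U 0
  unfold reverse
  rw [neg_zero, h0, translate_halfXYZ_kp]

/-- **Inviscid TG runs: every modal energy is an even function of time**, `E(k,−t) = E(k,t)` — hence so are
`E_K`, `Z_S` and the spectra. [folklore] -/
theorem tg_modalEnergy_even {U : ℝ → FourierVelocity} {S : Finset (Fin 3 → ℤ)}
    {c : ℝ → (Fin 3 → ℤ) → ℂ} (hU : IsGalerkinSolution U S 0 c fun _ _ _ => 0) (hs : IsSupportedOn U S)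
    (h0 : U 0 = TaylorGreenHat.tg) (t : ℝ) (k : Fin 3 → ℤ) : modalEnergy (U (-t)) k = modalEnergy (U t) k := by
  have h := congrArg (fun A => modalEnergy A k) (tg_translate_halfXYZ_eq_reverse hU hs h0 t)
  simp only [modalEnergy_translate, modalEnergy_reverse] at h
  exact h.symm

/-- **Inviscid TG runs: the truncated enstrophy (on any mode set) is an even function of time.** [folklore] -/
theorem tg_truncEnstrophy_even {U : ℝ → FourierVelocity} {S : Finset (Fin 3 → ℤ)}
    {c : ℝ → (Fin 3 → ℤ) → ℂ} (hU : IsGalerkinSolution U S 0 c fun _ _ _ => 0) (hs : IsSupportedOn U S)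
    (h0 : U 0 = TaylorGreenHat.tg) (t : ℝ) (K : Finset (Fin 3 → ℤ)) :
    truncEnstrophy (U (-t)) K = truncEnstrophy (U t) K := by
  unfold truncEnstrophy
  exact Finset.sum_congr rfl fun k _ => by rw [tg_modalEnergy_even hU hs h0 t k]

/-- **Inviscid TG runs: every mode-to-mode transfer is an odd function of time**, `T(k←p)(−t) = −T(k←p)(t)`.
[folklore] -/
theorem tg_modeTransfer_odd {U : ℝ → FourierVelocity} {S : Finset (Fin 3 → ℤ)}
    {c : ℝ → (Fin 3 → ℤ) → ℂ} (hU : IsGalerkinSolution U S 0 c fun _ _ _ => 0) (hs : IsSupportedOn U S)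
    (h0 : U 0 = TaylorGreenHat.tg) (t : ℝ) (k p : Fin 3 → ℤ) :
    modeTransfer (U (-t)) k p = -modeTransfer (U t) k p := by
  have h := congrArg (fun A => modeTransfer A k p) (tg_translate_halfXYZ_eq_reverse hU hs h0 t)
  simp only [modeTransfer_translate, modeTransfer_reverse] at h
  linarith

/-- … hence every shell-to-shell transfer is odd in time (and vanishes at `t = 0`). [folklore] -/
theorem tg_shellTransfer_odd {U : ℝ → FourierVelocity} {S : Finset (Fin 3 → ℤ)}
    {c : ℝ → (Fin 3 → ℤ) → ℂ} (hU : IsGalerkinSolution U S 0 c fun _ _ _ => 0) (hs : IsSupportedOn U S)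
    (h0 : U 0 = TaylorGreenHat.tg) (t : ℝ) (K P : Finset (Fin 3 → ℤ)) :
    shellTransfer (U (-t)) K P = -shellTransfer (U t) K P := by
  unfold shellTransfer
  rw [← Finset.sum_neg_distrib]
  refine Finset.sum_congr rfl fun k _ => ?_
  rw [← Finset.sum_neg_distrib]
  exact Finset.sum_congr rfl fun p _ => tg_modeTransfer_odd hU hs h0 t k p

/-- **Inviscid KP runs: modal energies even in time.** [folklore] -/
theorem kp_modalEnergy_even {U : ℝ → FourierVelocity} {S : Finset (Fin 3 → ℤ)}
    {c : ℝ → (Fin 3 → ℤ) → ℂ} (hU : IsGalerkinSolution U S 0 c fun _ _ _ => 0) (hs : IsSupportedOn U S)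
    (h0 : U 0 = KidaPelzHat.kp) (t : ℝ) (k : Fin 3 → ℤ) : modalEnergy (U (-t)) k = modalEnergy (U t) k := by
  have h := congrArg (fun A => modalEnergy A k) (kp_translate_halfXYZ_eq_reverse hU hs h0 t)
  simp only [modalEnergy_translate, modalEnergy_reverse] at h
  exact h.symm

/-- **Inviscid KP runs: mode-to-mode transfers odd in time.** [folklore] -/
theorem kp_modeTransfer_odd {U : ℝ → FourierVelocity} {S : Finset (Fin 3 → ℤ)}
    {c : ℝ → (Fin 3 → ℤ) → ℂ} (hU : IsGalerkinSolution U S 0 c fun _ _ _ => 0) (hs : IsSupportedOn U S)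
    (h0 : U 0 = KidaPelzHat.kp) (t : ℝ) (k p : Fin 3 → ℤ) :
    modeTransfer (U (-t)) k p = -modeTransfer (U t) k p := by
  have h := congrArg (fun A => modeTransfer A k p) (kp_translate_halfXYZ_eq_reverse hU hs h0 t)
  simp only [modeTransfer_translate, modeTransfer_reverse] at h
  linarith

/-! ## Planarity is a space-group invariance, hence persists; truncated 2D Euler conserves enstrophy from planar data

A coefficient field is planar (`PlanarEnstrophyConservation.IsPlanar`: carried by wavevectors with `k₂ = 0`,
no vertical component) iff it is fixed by EVERY vertical translation `τ_{(0,0,a)}` and by the reflection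
`z ↦ −z` (`reflZ` of LatticeSymmetry): `translate_vertical_of_planar`, `reflZ_act_of_planar`,
`isPlanar_of_invariant`. Both invariances persist along unforced Galerkin solutions (`translate_eq_self`,
`LatticeIsometry.act_eq_self`), so **planarity persists** (`isPlanar_persists`, on mode sets mapped into
themselves by `reflZ`), and the conditional conservation law of `PlanarEnstrophyConservation` becomes
unconditional: **`truncEnstrophy_eq_of_planar_datum`** — an unforced inviscid Galerkin solution supported in
such an `S` that is planar at ONE time has constant enstrophy `Z_S`. [folklore] -/

/-- The vertical translation vector `(0, 0, a)`. [folklore] -/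
def vertical (a : ℝ) : Fin 3 → ℝ := ![0, 0, a]

/-- `k·(0,0,a) = k₂ a`. [folklore] -/
theorem rdot_vertical (k : Fin 3 → ℤ) (a : ℝ) : rdot k (vertical a) = ((k 2 : ℤ) : ℝ) * a := by
  unfold rdot vertical
  simp [Fin.sum_univ_three]

/-- A field fixed by the translation by `a` vanishes wherever the phase `e^{-ik·a}` is `−1`. [folklore] -/
theorem coeff_eq_zero_of_translate_eq_self {A : FourierVelocity} {a : Fin 3 → ℝ} (h : translate a A = A)
    {k : Fin 3 → ℤ} (hk : phase a k = -1) : A.coeff k = 0 := by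
  funext j
  have hc := congrArg (fun B : FourierVelocity => B.coeff k j) h
  simp only [translate_coeff] at hc
  rw [hk] at hc
  have h2 : (2 : ℂ) * A.coeff k j = 0 := by linear_combination -hc
  simpa using h2

/-- **A planar field is fixed by every vertical translation.** [folklore] -/
theorem translate_vertical_of_planar {A : FourierVelocity} (hA : IsPlanar A) (a : ℝ) :
    translate (vertical a) A = A := by
  refine TaylorGreenHat.fourierVelocity_ext ?_
  funext k j
  rw [translate_coeff]
  by_cases hk : A.coeff k = 0
  · simp [hk]
  · have h2 : k 2 = 0 := hA.1 k hk
    have hph : phase (vertical a) k = 1 := by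
      refine phase_eq_one_of_even (n := 0) ?_ ⟨0, by norm_num⟩
      rw [rdot_vertical, h2]
      simp
    rw [hph, one_mul]

/-- **A planar field is fixed by `z ↦ −z`.** [folklore] -/
theorem reflZ_act_of_planar {A : FourierVelocity} (hA : IsPlanar A) : reflZ.act A = A := by
  refine TaylorGreenHat.fourierVelocity_ext ?_
  funext k i
  rw [LatticeIsometry.act_coeff, reflZ_invK]
  by_cases h2 : k 2 = 0
  · -- a horizontal wavevector is fixed by `reflZ`
    have e : (![k 0, k 1, -k 2] : Fin 3 → ℤ) = k := by
      funext l; fin_cases l <;> simp [h2]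
    rw [e]
    unfold reflZ
    fin_cases i
    · simp [Fin.sum_univ_three]
    · simp [Fin.sum_univ_three]
    · simp [Fin.sum_univ_three, hA.2 k]
  · -- off the plane both sides vanish
    have hk : A.coeff k = 0 := by
      by_contra h; exact h2 (hA.1 k h)
    have hk' : A.coeff ![k 0, k 1, -k 2] = 0 := by
      by_contra h
      have := hA.1 _ h
      simp only [Matrix.cons_val_two, Matrix.tail_cons, Matrix.head_cons, neg_eq_zero] at this
      exact h2 this
    rw [hk, hk']
    simp

/-- **Conversely**: a field fixed by every vertical translation and by `z ↦ −z` is planar. [folklore] -/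
theorem isPlanar_of_invariant {A : FourierVelocity} (hT : ∀ a : ℝ, translate (vertical a) A = A)
    (hR : reflZ.act A = A) : IsPlanar A := by
  -- off the plane: the translation by `π/k₂` has phase `−1`
  have hoff : ∀ k : Fin 3 → ℤ, k 2 ≠ 0 → A.coeff k = 0 := by
    intro k hk2
    have hk2R : ((k 2 : ℤ) : ℝ) ≠ 0 := by exact_mod_cast hk2
    refine coeff_eq_zero_of_translate_eq_self (hT (Real.pi / ((k 2 : ℤ) : ℝ))) ?_
    refine phase_eq_neg_one_of_odd (n := 1) ?_ ⟨0, by norm_num⟩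
    rw [rdot_vertical]
    push_cast
    field_simp
  refine ⟨fun k hk => ?_, fun k => ?_⟩
  · by_contra h2
    exact hk (hoff k h2)
  · by_cases h2 : k 2 = 0
    · -- on the plane `reflZ` flips the sign of the vertical component
      have hc := congrArg (fun B : FourierVelocity => B.coeff k 2) hR
      rw [LatticeIsometry.act_coeff, reflZ_invK] at hc
      have e : (![k 0, k 1, -k 2] : Fin 3 → ℤ) = k := by
        funext l; fin_cases l <;> simp [h2]
      rw [e] at hc
      unfold reflZ at hc
      simp [Fin.sum_univ_three] at hc
      -- `hc : -A.coeff k 2 = A.coeff k 2`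
      have h2' : (2 : ℂ) * A.coeff k 2 = 0 := by linear_combination -hc
      simpa using h2'
    · rw [hoff k h2]
      rfl

/-- **PLANARITY PERSISTS**: an unforced Galerkin solution supported in a mode set mapped into itself by
`reflZ`, planar at one time, is planar at every time. [folklore] -/
theorem isPlanar_persists {U : ℝ → FourierVelocity} {S : Finset (Fin 3 → ℤ)} {ν : ℝ}
    {c : ℝ → (Fin 3 → ℤ) → ℂ} (hU : IsGalerkinSolution U S ν c fun _ _ _ => 0) (hs : IsSupportedOn U S)
    (hS : ∀ p ∈ S, reflZ.invK p ∈ S) (hS' : ∀ p ∈ S, reflZ.actK p ∈ S) {t₀ : ℝ}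
    (h0 : IsPlanar (U t₀)) (t : ℝ) : IsPlanar (U t) :=
  isPlanar_of_invariant
    (fun a => translate_eq_self hU hs (vertical a) (translate_vertical_of_planar h0 a) t)
    (reflZ.act_eq_self hU hs hS hS' (reflZ_act_of_planar h0) t)

/-- **TRUNCATED TWO-DIMENSIONAL EULER CONSERVES ENSTROPHY** (unconditional form): an unforced inviscid
Galerkin solution supported in a mode set mapped into itself by `reflZ` (e.g. any box or ball mask) that
is planar at one time has constant `Z_S`. [folklore: Fjørtoft 1953, Kraichnan 1967; cf.
`PlanarEnstrophyConservation.truncEnstrophy_eq_of_planar_euler`] -/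
theorem truncEnstrophy_eq_of_planar_datum {U : ℝ → FourierVelocity} {S : Finset (Fin 3 → ℤ)}
    {c : ℝ → (Fin 3 → ℤ) → ℂ} (hU : IsGalerkinSolution U S 0 c fun _ _ _ => 0) (hs : IsSupportedOn U S)
    (hS : ∀ p ∈ S, reflZ.invK p ∈ S) (hS' : ∀ p ∈ S, reflZ.actK p ∈ S) {t₀ : ℝ} (h0 : IsPlanar (U t₀))
    (s t : ℝ) : truncEnstrophy (U s) S = truncEnstrophy (U t) S :=
  truncEnstrophy_eq_of_planar_euler hU (fun x => isPlanar_persists hU hs hS hS' h0 x) hs s t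

/-- With viscosity `ν ≥ 0`: from a planar datum the truncated enstrophy is non-increasing. [folklore] -/
theorem truncEnstrophy_antitone_of_planar_datum {U : ℝ → FourierVelocity} {S : Finset (Fin 3 → ℤ)} {ν : ℝ}
    (hν : 0 ≤ ν) {c : ℝ → (Fin 3 → ℤ) → ℂ} (hU : IsGalerkinSolution U S ν c fun _ _ _ => 0)
    (hs : IsSupportedOn U S) (hS : ∀ p ∈ S, reflZ.invK p ∈ S) (hS' : ∀ p ∈ S, reflZ.actK p ∈ S) {t₀ : ℝ}
    (h0 : IsPlanar (U t₀)) : Antitone fun s => truncEnstrophy (U s) S :=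
  truncEnstrophy_antitone_of_planar hν hU (fun x => isPlanar_persists hU hs hS hS' h0 x) hs

end ShellTransfer

end Literature.Analysis.FluidPDE.FluidComputer

end
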